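import Summits.CriticalPhenomena.PercolationContinuityZ3.Theorems.PercNearOneGluingNoHeavyQuantWideCellPieceC
import HarnessLib

/-!
# QUANT lane R8, T-DEC: the WIDE CELL of `LightSliceWide` — the pricing of piece C and of piece E (the expensive piece: the lows
# `P1 = p + l`, `M1 = m + l` against the mids `PG = p + h`, `M1`) (census-2 g60)

builds on p205010 (kernel theorem, internal audit signed; external expert review pending)

Support file (`--supports stmt-CriticalPhenomena-4575`), QUANT lane seat prim-quant-census-2 (gen 60), rung R8 of `…/quant/LADDER.md`.
Memo `run/shared/lean/prim/quant/prim-quant-census-2-g60/WIDE-G60.md` §3–§4.  Theorems only, standard axioms, no sorries, no definitions.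
Setting as in `…QuantWideCellPieceC`; in addition the expensive segment `(l, h)` of side 2 has rate `ρ_e ∈ (x, 1)` and, in units of
`B′ = h′ − l′`, `w := (T₂ − 2l)/B′ = ρ_e·ε` (`ε = (h−l)/B′ > 1`, so `w > ρ_e`); masses `m_E` (expensive) and `m_C` (cheap) with the balance
`m_E(c₁ − u) = m_C(u − c₂)`, i.e. `m_E/m_C = (x−c)(1−ρ_e)/((1+x−c)(ρ_e−x))`.  Pairs of piece E: `P1 → PG` (rate `ρ_S = ρ_e(w+ra)/w`, heavy,
compatible iff `ρ_S < 1`), `M1 → PG` (rate `ρ_N = ρ_e(w+ra−2a)/(w−aρ_e)`, when `M1` is a conv-low: `w + ra > 2a`), `P1 → M1` (rate `(w+ra)/a`,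
heavy, when `M1` is a mid).
* `pieceC` — the pricing wrapper of piece C (`…PieceC.restC_le/_theta` give the admissible `R`).
* `UN_le` — the one inequality between the two pairs into `PG`: `U_{M1G}·(w + ra) ≤ U_{P1G}·(w + ra − a)` (light and heavy `M1 → PG`).
* **`pieceE_low`** (`PG` a mid, `M1` a conv-low): `(1−γ)m_E α_{P1} + γ m_E α_{M1} ≤ β_G·(1−γ)m_E c₁ + γ m_E + γ m_C (x−c)/(1+x−c)`.
* **`pieceE_mid`** (`PG` a mid, `M1` a mid): `(1−γ)m_E α_{P1} ≤ β_G·(1−γ)m_E c₁ + β_1·γ m_E + γ m_E + γ m_C (x−c)θ/(1+x−c)`,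
  `θ = a/(w+ra)` if `P1 → M1` is compatible, else `1`.
All by hand (memo §4): the only inputs are `(1+x−r)r ≤ γ`, the balance, and `UN_le`.

[this work].  The gluing rows served [cite: KozmaNitzan2024, Conjecture 3 (p. 15)]; product measure [cite: Grimmett1999, §1.3 p. 10].
-/

noncomputable section

namespace Summit.CriticalPhenomena.PercolationContinuityZ3.Theorems

namespace Quant

namespace LawDec

namespace WideCell

/-- light usage `U_ℓ(ρ) = (x² + (1−x)ρ)/((1−x)(1+x−ρ))` -/
local notation3 "UL[" x ", " ρ "]" => ((x : ℝ) ^ 2 + (1 - x) * ρ) / ((1 - x) * (1 + x - ρ))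

/-- **THE PRICING OF PIECE C.**  For prices `β_H, β_M ≥ 0` and a value `α ≤ 1`, `α ≤ U_{P2H}β_H`, `α ≤ U_{P2M}β_M` (if compatible):
`(1−γ)m_C·α ≤ β_H·((1−γ)m_C c₂) + β_M·(γ m_C) + m_C·R` for every `R ≥ max(R_C, 0)`. [this work] -/
theorem pieceC (x r c a γ ρP mC c₂ UH UM βH βM α R : ℝ) (cM : Prop) [Decidable cM] (hγ : γ = x ^ 2 + (1 - x) * r)
    (hx0 : 0 < x) (hx1 : x < 1) (hr0 : 0 ≤ r) (hrx : r < x) (hc0 : 0 ≤ c) (hcx : c < x) (ha0 : 0 < a) (hρP : ρP = c + r * a)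
    (hρP1 : ρP < 1) (hmC : 0 < mC) (hc₂ : c₂ = UL[x, c]) (hUHl : ρP ≤ x → UH = UL[x, ρP]) (hUHh : x ≤ ρP → UH = ρP / (1 - ρP))
    (hcM : cM ↔ ρP < a) (hUMl : ρP / a ≤ x → ρP < a → UM = UL[x, ρP / a]) (hUMh : x ≤ ρP / a → ρP < a → UM = (ρP / a) / (1 - ρP / a))
    (hβH : 0 ≤ βH) (hβM : 0 ≤ βM) (hα1 : α ≤ 1) (hαH : α ≤ UH * βH) (hαM : cM → α ≤ UM * βM)
    (hR : max ((1 - γ) - (1 - γ) * c₂ / UH - (if cM then γ / UM else 0)) 0 ≤ R) :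
    (1 - γ) * mC * α ≤ βH * ((1 - γ) * mC * c₂) + βM * (γ * mC) + mC * R := by
  have hγ0 : 0 ≤ γ := by rw [hγ]; nlinarith
  have hγ1 : γ < 1 := by rw [hγ]; nlinarith
  have hρP0 : 0 ≤ ρP := by rw [hρP]; nlinarith
  have hc₂0 : 0 < c₂ := by rw [hc₂]; exact TwoMidCell.UL_pos x c hx0 hx1 hc0 (by linarith)
  have hUH0 : 0 < UH := by
    rcases le_or_gt ρP x with hl | hh
    · rw [hUHl hl]; exact TwoMidCell.UL_pos x ρP hx0 hx1 hρP0 (by linarith)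
    · rw [hUHh hh.le]; exact div_pos (by linarith) (by linarith)
  have hR0 : 0 ≤ R := le_trans (le_max_right _ _) hR
  -- absorbable amounts
  obtain ⟨qH, hqH⟩ : ∃ qH : ℝ, qH = (1 - γ) * mC * c₂ / UH := ⟨_, rfl⟩
  obtain ⟨qM, hqM⟩ : ∃ qM : ℝ, qM = (if cM then γ * mC / UM else 0) := ⟨_, rfl⟩
  have hqH0 : 0 ≤ qH := by rw [hqH]; exact div_nonneg (mul_nonneg (mul_nonneg (by linarith) hmC.le) hc₂0.le) hUH0.le
  have hqHα : qH * α ≤ βH * ((1 - γ) * mC * c₂) := by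
    have := mul_le_mul_of_nonneg_left hαH hqH0
    have e : qH * (UH * βH) = βH * ((1 - γ) * mC * c₂) := by rw [hqH]; field_simp
    linarith
  have hqM0 : 0 ≤ qM := by
    rw [hqM]; split_ifs with hc
    · have hcomp := hcM.1 hc
      have hUM0 : 0 < UM := by
        rcases le_or_gt (ρP / a) x with hl | hh
        · rw [hUMl hl hcomp]; exact TwoMidCell.UL_pos x _ hx0 hx1 (div_nonneg hρP0 ha0.le) (by linarith)
        · rw [hUMh hh.le hcomp]
          exact div_pos (div_pos (by
            have : 0 < ρP / a := lt_trans hx0 hh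
            have := mul_pos this ha0; rwa [div_mul_cancel₀ _ ha0.ne'] at this) ha0) (by rw [sub_pos, div_lt_one ha0]; exact hcomp)
      exact div_nonneg (mul_nonneg hγ0 hmC.le) hUM0.le
    · exact le_rfl
  have hqMα : qM * α ≤ βM * (γ * mC) := by
    rw [hqM]; split_ifs with hc
    · have hcomp := hcM.1 hc
      have hUM0 : 0 < UM := by
        rcases le_or_gt (ρP / a) x with hl | hh
        · rw [hUMl hl hcomp]; exact TwoMidCell.UL_pos x _ hx0 hx1 (div_nonneg hρP0 ha0.le) (by linarith)
        · rw [hUMh hh.le hcomp]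
          exact div_pos (div_pos (by
            have : 0 < ρP / a := lt_trans hx0 hh
            have := mul_pos this ha0; rwa [div_mul_cancel₀ _ ha0.ne'] at this) ha0) (by rw [sub_pos, div_lt_one ha0]; exact hcomp)
      have h0 : 0 ≤ γ * mC / UM := div_nonneg (mul_nonneg hγ0 hmC.le) hUM0.le
      have := mul_le_mul_of_nonneg_left (hαM hc) h0
      have e : γ * mC / UM * (UM * βM) = βM * (γ * mC) := by field_simp
      linarith
    · rw [zero_mul]; exact mul_nonneg hβM (mul_nonneg hγ0 hmC.le)
  -- the decomposition `(1−γ)m_C = qH + qM + m_C·R_C`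
  have hdec : (1 - γ) * mC = qH + qM + mC * ((1 - γ) - (1 - γ) * c₂ / UH - (if cM then γ / UM else 0)) := by
    rw [hqH, hqM]; split_ifs <;> ring
  have hRC : (1 - γ) - (1 - γ) * c₂ / UH - (if cM then γ / UM else 0) ≤ R := le_trans (le_max_left _ _) hR
  have hpos : 0 ≤ βH * ((1 - γ) * mC * c₂) + βM * (γ * mC) + mC * R :=
    add_nonneg (add_nonneg (mul_nonneg hβH (mul_nonneg (mul_nonneg (by linarith) hmC.le) hc₂0.le))
      (mul_nonneg hβM (mul_nonneg hγ0 hmC.le))) (mul_nonneg hmC.le hR0)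
  rcases lt_or_ge α 0 with hαneg | hαnn
  · have : (1 - γ) * mC * α ≤ 0 := mul_nonpos_of_nonneg_of_nonpos (mul_nonneg (by linarith) hmC.le) hαneg.le
    linarith
  rcases le_or_gt ((1 - γ) - (1 - γ) * c₂ / UH - (if cM then γ / UM else 0)) 0 with hneg | hposR
  · -- mids over-sufficient: `(1−γ)m_C ≤ qH + qM`
    have hle : (1 - γ) * mC ≤ qH + qM := by nlinarith [mul_nonpos_of_nonneg_of_nonpos hmC.le hneg]
    have := mul_le_mul_of_nonneg_right hle hαnn
    nlinarith [mul_nonneg hmC.le hR0]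
  · have e : (1 - γ) * mC * α = qH * α + qM * α
        + mC * ((1 - γ) - (1 - γ) * c₂ / UH - (if cM then γ / UM else 0)) * α := by rw [hdec]; ring
    rw [e]
    have h3 : mC * ((1 - γ) - (1 - γ) * c₂ / UH - (if cM then γ / UM else 0)) * α
        ≤ mC * ((1 - γ) - (1 - γ) * c₂ / UH - (if cM then γ / UM else 0)) :=
      mul_le_of_le_one_right (mul_nonneg hmC.le hposR.le) hα1
    have h4 := mul_le_mul_of_nonneg_left hRC hmC.le
    linarith

/-! ### piece E -/

/-- **`U_{M1G}·(w + ra) ≤ U_{P1G}·(w + ra − a)`** (both pairs into the mid `PG`; `M1 → PG` light or heavy). [this work] -/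
theorem UN_le (x r a ρe w ρS ρN US UN : ℝ) (hx0 : 0 < x) (hx1 : x < 1) (hr0 : 0 ≤ r) (hrx : r < x) (ha0 : 0 < a) (ha4 : 4 * a ≤ 1)
    (hρe : x < ρe) (hρe1 : ρe < 1) (hwe : ρe < w) (hlow : 2 * a < w + r * a)
    (hρS : ρS = ρe * (w + r * a) / w) (hρS1 : ρS < 1) (hUS : US = ρS / (1 - ρS))
    (hρN : ρN = ρe * (w + r * a - 2 * a) / (w - a * ρe)) (hUNl : ρN ≤ x → UN = UL[x, ρN]) (hUNh : x ≤ ρN → UN = ρN / (1 - ρN)) :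
    UN * (w + r * a) ≤ US * (w + r * a - a) := by
  have hw0 : 0 < w := by linarith
  have hwa : 0 < w - a * ρe := by nlinarith
  have hra : 0 ≤ r * a := mul_nonneg hr0 ha0.le
  have hwra : 0 < w + r * a := by linarith
  have hwra' : 0 < w + r * a - a := by linarith
  have hρN0 : 0 < ρN := by rw [hρN]; exact div_pos (mul_pos (by linarith) (by linarith)) hwa
  have hρe0 : 0 < ρe := by linarith
  have hρNe : ρN ≤ ρe := by
    rw [hρN, div_le_iff₀ hwa]
    have : 0 ≤ ρe * a * (2 - ρe - r) := mul_nonneg (mul_nonneg hρe0.le ha0.le) (by linarith)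
    nlinarith [this]
  have hρSe : ρe ≤ ρS := by
    rw [hρS, le_div_iff₀ hw0]; nlinarith
  have hρS0 : 0 < ρS := by linarith
  rcases le_or_gt ρN x with hl | hh
  · -- light `M1 → PG`: reduces to `g_N (w − aρe) ≤ ρe (w + ra − a)` with `g_N = x² + (1−x)ρN`, `ρN(w − aρe) = ρe(w+ra−2a)`
    have hg1 : x ^ 2 + (1 - x) * ρN < 1 := by nlinarith
    have hNw : ρN * (w - a * ρe) = ρe * (w + r * a - 2 * a) := by rw [hρN, div_mul_cancel₀ _ hwa.ne']
    have key : (x ^ 2 + (1 - x) * ρN) * (w - a * ρe) ≤ ρe * (w + r * a - a) := by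
      have e : (x ^ 2 + (1 - x) * ρN) * (w - a * ρe) - ρe * (w + r * a - a)
          = -(x * w * (ρe - x) + a * ρe * ((1 - x) ^ 2 + x * r)) := by
        have : (x ^ 2 + (1 - x) * ρN) * (w - a * ρe) = x ^ 2 * (w - a * ρe) + (1 - x) * (ρN * (w - a * ρe)) := by ring
        rw [this, hNw]; ring
      have h1 : 0 ≤ x * w * (ρe - x) := mul_nonneg (mul_nonneg hx0.le hw0.le) (by linarith)
      have h2 : 0 ≤ a * ρe * ((1 - x) ^ 2 + x * r) := mul_nonneg (mul_nonneg ha0.le hρe0.le) (by positivity)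
      linarith
    have key' : (x ^ 2 + (1 - x) * ρN) * (w - ρe * (w + r * a)) ≤ ρe * (w + r * a - a) * (1 - (x ^ 2 + (1 - x) * ρN)) := by
      nlinarith [key]
    have hSw : 0 < w - ρe * (w + r * a) := by
      have : ρe * (w + r * a) < w := by
        have h := hρS1; rw [hρS, div_lt_one hw0] at h; exact h
      linarith
    have hUN' : UN = (x ^ 2 + (1 - x) * ρN) / (1 - (x ^ 2 + (1 - x) * ρN)) := by
      rw [hUNl hl]; congr 1; ring
    have hUS' : US = ρe * (w + r * a) / (w - ρe * (w + r * a)) := by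
      rw [hUS, hρS]; field_simp
    rw [hUN', hUS', div_mul_eq_mul_div, div_mul_eq_mul_div, div_le_div_iff₀ (by linarith) hSw]
    have := mul_le_mul_of_nonneg_left key' hwra.le
    nlinarith [this]
  · -- heavy `M1 → PG`: `UN/US ≤ ρN/ρS ≤ (w+ra−a)/(w+ra)`
    rw [hUNh hh.le, hUS]
    have hρN1 : ρN < 1 := by linarith
    have step1 : ρN * (w + r * a) ≤ ρS * (w + r * a - a) := by
      rw [hρN, hρS, div_mul_eq_mul_div, div_mul_eq_mul_div, div_le_div_iff₀ hwa hw0]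
      have : 0 ≤ a * w * (1 - ρe) + a ^ 2 * ρe * (1 - r) :=
        add_nonneg (mul_nonneg (mul_nonneg ha0.le hw0.le) (by linarith)) (mul_nonneg (mul_nonneg (sq_nonneg a) hρe0.le) (by linarith))
      nlinarith [mul_pos (by linarith : (0:ℝ) < ρe) hwra]
    rw [div_mul_eq_mul_div, div_mul_eq_mul_div, div_le_div_iff₀ (by linarith) (by linarith)]
    have h1 : 0 ≤ 1 - ρS := by linarith
    have h2 : (1 - ρS) ≤ (1 - ρN) := by linarith
    calc ρN * (w + r * a) * (1 - ρS) ≤ ρS * (w + r * a - a) * (1 - ρS) := mul_le_mul_of_nonneg_right step1 h1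
      _ ≤ ρS * (w + r * a - a) * (1 - ρN) := mul_le_mul_of_nonneg_left h2 (mul_nonneg hρS0.le hwra'.le)

/-- the balance in product form: `m_E (1+x−c)(ρ_e − x) = m_C (x−c)(1−ρ_e)`. [this work] -/
theorem kappa_id (x c ρe mE mC c₁ c₂ : ℝ) (hx1 : x < 1) (hcx : c < x) (hρe1 : ρe < 1) (hc₁ : c₁ = ρe / (1 - ρe))
    (hc₂ : c₂ = UL[x, c]) (hbal : mE * (c₁ - x / (1 - x)) = mC * (x / (1 - x) - c₂)) :
    mE * ((1 + x - c) * (ρe - x)) = mC * ((x - c) * (1 - ρe)) := by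
  have h1x : (1:ℝ) - x ≠ 0 := by linarith
  have h1e : (1:ℝ) - ρe ≠ 0 := by linarith
  have hxc : (1:ℝ) + x - c ≠ 0 := by linarith
  have e1 : c₁ - x / (1 - x) = (ρe - x) / ((1 - ρe) * (1 - x)) := by rw [hc₁]; field_simp; ring
  have e2 : x / (1 - x) - c₂ = (x - c) / ((1 - x) * (1 + x - c)) := by rw [hc₂]; field_simp; ring
  rw [e1, e2] at hbal
  field_simp at hbal
  linear_combination hbal

set_option maxHeartbeats 1600000 in
/-- algebraic core of `pieceE_low` (compatible `P1 → PG`): the leftover of piece E beyond `γ m_E` is at most `γ m_C (x−c)/(1+x−c)`.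
[this work] -/
theorem low_core (x c r a γ ρe w mE mC c₁ US UN : ℝ) (hγ0 : 0 ≤ γ) (hmE : 0 ≤ mE) (hmC : 0 ≤ mC) (hUS0 : 0 < US)
    (hxc0 : 0 ≤ x - c) (hxc : 0 < 1 + x - c) (hs0 : 0 < 1 - ρe) (hρx : 0 < ρe - x) (hwra : 0 < w + r * a) (haw : a ≤ w + r * a)
    (hκ : mE * ((1 + x - c) * (ρe - x)) = mC * ((x - c) * (1 - ρe)))
    (hUSc : (US - c₁) * ((1 - ρe) * (w + r * a)) = US * (r * a)) (hUNle : UN * (w + r * a) ≤ US * (w + r * a - a))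
    (key : (1 - γ) * (r * a) ≤ (1 - x) * γ * a) :
    ((1 - γ) * mE * (US - c₁) - γ * mE * (US - UN)) * (1 + x - c) ≤ γ * mC * (x - c) * US := by
  have hpos : 0 < (1 - ρe) * (ρe - x) * (w + r * a) := mul_pos (mul_pos hs0 hρx) hwra
  refine le_of_mul_le_mul_right ?_ hpos
  have t1 : γ * mE * (US * a) ≤ γ * mE * ((US - UN) * (w + r * a)) := by
    refine mul_le_mul_of_nonneg_left ?_ (mul_nonneg hγ0 hmE); linarith
  have hA' : (1 - γ) * mE * (US - c₁) * (1 + x - c) * ((1 - ρe) * (ρe - x) * (w + r * a))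
      = (1 - γ) * (US * (r * a)) * (mC * ((x - c) * (1 - ρe))) := by
    calc (1 - γ) * mE * (US - c₁) * (1 + x - c) * ((1 - ρe) * (ρe - x) * (w + r * a))
        = (1 - γ) * ((US - c₁) * ((1 - ρe) * (w + r * a))) * (mE * ((1 + x - c) * (ρe - x))) := by ring
      _ = (1 - γ) * (US * (r * a)) * (mC * ((x - c) * (1 - ρe))) := by rw [hUSc, hκ]
  have hB1 := mul_le_mul_of_nonneg_right t1 (mul_nonneg hxc.le (mul_pos hs0 hρx).le)
  have hB2 : γ * mE * (US * a) * ((1 + x - c) * ((1 - ρe) * (ρe - x)))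
      = γ * US * a * (1 - ρe) * (mC * ((x - c) * (1 - ρe))) := by
    calc γ * mE * (US * a) * ((1 + x - c) * ((1 - ρe) * (ρe - x)))
        = γ * US * a * (1 - ρe) * (mE * ((1 + x - c) * (ρe - x))) := by ring
      _ = γ * US * a * (1 - ρe) * (mC * ((x - c) * (1 - ρe))) := by rw [hκ]
  have sc : (1 - γ) * (r * a) - γ * a * (1 - ρe) ≤ γ * (ρe - x) * (w + r * a) := by
    have := mul_le_mul_of_nonneg_left haw (mul_nonneg hγ0 hρx.le)
    nlinarith [this, key]
  have hsc := mul_le_mul_of_nonneg_left sc (mul_nonneg (mul_nonneg hUS0.le hmC) (mul_nonneg hxc0 hs0.le))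
  linarith [hA', hB1, hB2, hsc]

/-- algebraic core of the incompatible case (`ρ_S ≥ 1`, so `1 − ρe ≤ ra`; `γ < 1/2`): `(1−γ)m_E ≤ γ m_C (x−c)/(1+x−c)`. [this work] -/
theorem incompat_core (x c r a γ ρe mE mC : ℝ) (hγ : γ = x ^ 2 + (1 - x) * r) (hx0 : 0 < x) (hx1 : x < 1) (hr0 : 0 ≤ r)
    (hrx : r < x) (hcx : c < x) (ha0 : 0 < a) (ha4 : 4 * a ≤ 1) (hρe : x < ρe) (hρe1 : ρe < 1) (hmC : 0 ≤ mC)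
    (hκ : mE * ((1 + x - c) * (ρe - x)) = mC * ((x - c) * (1 - ρe))) (hs : 1 - ρe ≤ r * a) (hg : 2 * γ < 1) :
    (1 - γ) * mE ≤ γ * mC * ((x - c) / (1 + x - c)) := by
  have hγ0 : 0 ≤ γ := by rw [hγ]; nlinarith
  have hγ1 : γ < 1 := by rw [hγ]; nlinarith
  have h1x : 0 < 1 - x := by linarith
  have hxc : 0 < 1 + x - c := by linarith
  have key := key_ra x r a γ hγ hx1 ha0.le
  have hx2 : x ^ 2 < 1 / 2 := by
    have := mul_nonneg h1x.le hr0; rw [hγ] at hg; linarith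
  have hx34 : x < 3 / 4 := by
    by_contra h
    push Not at h
    have : (3:ℝ) / 4 * (3 / 4) ≤ x * x := mul_le_mul h h (by norm_num) (by linarith)
    nlinarith
  have h3 : r * a ≤ (1 - x) * (1 - a) := by
    have := mul_le_mul_of_nonneg_right hrx.le ha0.le
    nlinarith
  have sc : (1 - γ) * (1 - ρe) ≤ γ * (ρe - x) := by
    have h1 : (1 - γ) * (1 - ρe) ≤ (1 - γ) * (r * a) := mul_le_mul_of_nonneg_left hs (by linarith)
    have h4 : 0 ≤ γ * ((1 - x) * (1 - a) - (1 - ρe)) := mul_nonneg hγ0 (by linarith)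
    nlinarith [h1, key, h4]
  rw [mul_div_assoc', le_div_iff₀ hxc]
  have hpos : (0:ℝ) < ρe - x := by linarith
  refine le_of_mul_le_mul_right ?_ hpos
  have e : (1 - γ) * mE * (1 + x - c) * (ρe - x) = (1 - γ) * (1 - ρe) * (mC * (x - c)) := by
    calc (1 - γ) * mE * (1 + x - c) * (ρe - x) = (1 - γ) * (mE * ((1 + x - c) * (ρe - x))) := by ring
      _ = (1 - γ) * (mC * ((x - c) * (1 - ρe))) := by rw [hκ]
      _ = (1 - γ) * (1 - ρe) * (mC * (x - c)) := by ring
  rw [e]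
  have h5 := mul_le_mul_of_nonneg_right sc (mul_nonneg hmC (by linarith : (0:ℝ) ≤ x - c))
  nlinarith [h5]

set_option maxHeartbeats 1600000 in
/-- **PIECE E, `PG` a mid and `M1` a conv-low.**  See the module docstring. [this work] -/
theorem pieceE_low (x r c a γ ρe w mE mC c₁ c₂ ρS ρN US UN βG αP1 αM1 : ℝ) (cS : Prop)
    (hγ : γ = x ^ 2 + (1 - x) * r) (hx0 : 0 < x) (hx1 : x < 1) (hr0 : 0 ≤ r) (hrx : r < x) (hcx : c < x)
    (ha0 : 0 < a) (ha4 : 4 * a ≤ 1) (hρe : x < ρe) (hρe1 : ρe < 1) (hwe : ρe < w) (hlow : 2 * a < w + r * a)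
    (hmE : 0 ≤ mE) (hmC : 0 < mC) (hc₁ : c₁ = ρe / (1 - ρe)) (hc₂ : c₂ = UL[x, c])
    (hbal : mE * (c₁ - x / (1 - x)) = mC * (x / (1 - x) - c₂))
    (hρS : ρS = ρe * (w + r * a) / w) (hcS : cS ↔ ρS < 1) (hUS : ρS < 1 → US = ρS / (1 - ρS))
    (hρN : ρN = ρe * (w + r * a - 2 * a) / (w - a * ρe)) (hUNl : ρN ≤ x → UN = UL[x, ρN]) (hUNh : x ≤ ρN → UN = ρN / (1 - ρN))
    (hβG : 0 ≤ βG) (hαP1 : αP1 ≤ 1) (hαM1 : αM1 ≤ 1) (hαS : cS → αP1 ≤ US * βG) (hαN : αM1 ≤ UN * βG) :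
    (1 - γ) * mE * αP1 + γ * mE * αM1 ≤ βG * ((1 - γ) * mE * c₁) + γ * mE + γ * mC * ((x - c) / (1 + x - c)) := by
  have hγ0 : 0 ≤ γ := by rw [hγ]; nlinarith
  have hγ1 : γ < 1 := by rw [hγ]; nlinarith
  have h1x : 0 < 1 - x := by linarith
  have hρe0 : 0 < ρe := by linarith
  have hs0 : 0 < 1 - ρe := by linarith
  have hw0 : 0 < w := by linarith
  have hwa : 0 < w - a * ρe := by
    have : a * ρe < 1 * ρe := mul_lt_mul_of_pos_right (by linarith) hρe0
    linarith
  have hra : 0 ≤ r * a := mul_nonneg hr0 ha0.le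
  have hwra : 0 < w + r * a := by linarith
  have hxc : 0 < 1 + x - c := by linarith
  have hxc0 : 0 ≤ x - c := by linarith
  have hκ := kappa_id x c ρe mE mC c₁ c₂ hx1 hcx hρe1 hc₁ hc₂ hbal
  have hc₁0 : 0 < c₁ := by rw [hc₁]; exact div_pos hρe0 hs0
  have hlast : 0 ≤ γ * mC * ((x - c) / (1 + x - c)) := mul_nonneg (mul_nonneg hγ0 hmC.le) (div_nonneg hxc0 hxc.le)
  -- the rate `ρN` and the usage `UN`
  have hρN0 : 0 < ρN := by rw [hρN]; exact div_pos (mul_pos hρe0 (by linarith)) hwa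
  have hρNe : ρN ≤ ρe := by
    rw [hρN, div_le_iff₀ hwa]
    have : 0 ≤ ρe * a * (2 - ρe - r) := mul_nonneg (mul_nonneg hρe0.le ha0.le) (by linarith)
    linarith
  have hUN0 : 0 < UN := by
    rcases le_or_gt ρN x with hl | hh
    · rw [hUNl hl]; exact TwoMidCell.UL_pos x ρN hx0 hx1 hρN0.le (by linarith)
    · rw [hUNh hh.le]; exact div_pos hρN0 (by linarith)
  have hUNc₁ : UN ≤ c₁ := by
    rcases le_or_gt ρN x with hl | hh
    · rw [hUNl hl, hc₁]
      have h1 := CrossGiantCell.Ul_le_u x ρN hx0 hx1 hl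
      have h2 : x / (1 - x) ≤ ρe / (1 - ρe) := by
        rw [div_le_div_iff₀ h1x hs0]; nlinarith
      exact h1.trans h2
    · rw [hUNh hh.le, hc₁]; exact TwoMidCell.UH_mono ρe ρN hρe1 hρNe
  have hcap0 : 0 ≤ (1 - γ) * mE * c₁ := mul_nonneg (mul_nonneg (by linarith) hmE) hc₁0.le
  have hP1triv : (1 - γ) * mE * αP1 ≤ (1 - γ) * mE := mul_le_of_le_one_right (mul_nonneg (by linarith) hmE) hαP1
  rcases le_or_gt ((1 - γ) * mE * c₁) (γ * mE * UN) with hA | hB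
  · -- case A: the mid `PG` cannot even absorb all of `M1`
    have hq0 : 0 ≤ (1 - γ) * mE * c₁ / UN := div_nonneg hcap0 hUN0.le
    have h1 : (1 - γ) * mE * c₁ / UN * αM1 ≤ βG * ((1 - γ) * mE * c₁) := by
      have := mul_le_mul_of_nonneg_left hαN hq0
      have e : (1 - γ) * mE * c₁ / UN * (UN * βG) = βG * ((1 - γ) * mE * c₁) := by field_simp
      linarith
    have hcoef : 0 ≤ γ * mE - (1 - γ) * mE * c₁ / UN := by
      rw [sub_nonneg, div_le_iff₀ hUN0]; exact hA
    have h2 : (γ * mE - (1 - γ) * mE * c₁ / UN) * αM1 ≤ γ * mE - (1 - γ) * mE * c₁ / UN :=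
      mul_le_of_le_one_right hcoef hαM1
    have h3 : (1 - γ) * mE ≤ (1 - γ) * mE * c₁ / UN := by
      rw [le_div_iff₀ hUN0]
      exact mul_le_mul_of_nonneg_left hUNc₁ (mul_nonneg (by linarith) hmE)
    have e : γ * mE * αM1 = (1 - γ) * mE * c₁ / UN * αM1 + (γ * mE - (1 - γ) * mE * c₁ / UN) * αM1 := by ring
    linarith
  · -- case B: `PG` absorbs all of `M1` (usage `UN`) first
    have hM1 : γ * mE * αM1 ≤ γ * mE * UN * βG := by
      have := mul_le_mul_of_nonneg_left hαN (mul_nonneg hγ0 hmE); linarith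
    by_cases hS : cS
    · -- `P1 → PG` compatible: the rest of `PG` absorbs part of `P1` at usage `US`
      have hρS1 : ρS < 1 := hcS.1 hS
      have hρSe : ρe ≤ ρS := by rw [hρS, le_div_iff₀ hw0]; nlinarith
      have hUSv := hUS hρS1
      have hUS0 : 0 < US := by rw [hUSv]; exact div_pos (by linarith) (by linarith)
      have hUSc₁ : c₁ ≤ US := by rw [hUSv, hc₁]; exact TwoMidCell.UH_mono ρS ρe hρS1 hρSe
      obtain ⟨D, hD⟩ : ∃ D : ℝ, D = (1 - γ) * mE * c₁ - γ * mE * UN := ⟨_, rfl⟩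
      have hD0 : 0 < D := by rw [hD]; linarith
      have hq0 : 0 ≤ D / US := div_nonneg hD0.le hUS0.le
      have h1 : D / US * αP1 ≤ D * βG := by
        have := mul_le_mul_of_nonneg_left (hαS hS) hq0
        have e : D / US * (US * βG) = D * βG := by field_simp
        linarith
      have hcoef : 0 ≤ (1 - γ) * mE - D / US := by
        rw [sub_nonneg, div_le_iff₀ hUS0, hD]
        have := mul_le_mul_of_nonneg_left hUSc₁ (mul_nonneg (by linarith : (0:ℝ) ≤ 1 - γ) hmE)
        have h0 : 0 ≤ γ * mE * UN := mul_nonneg (mul_nonneg hγ0 hmE) hUN0.le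
        linarith
      have h2 : ((1 - γ) * mE - D / US) * αP1 ≤ (1 - γ) * mE - D / US := mul_le_of_le_one_right hcoef hαP1
      have eP : (1 - γ) * mE * αP1 = D / US * αP1 + ((1 - γ) * mE - D / US) * αP1 := by ring
      have hUNle := UN_le x r a ρe w ρS ρN US UN hx0 hx1 hr0 hrx ha0 ha4 hρe hρe1 hwe hlow hρS hρS1 hUSv hρN hUNl hUNh
      have hUSc : (US - c₁) * ((1 - ρe) * (w + r * a)) = US * (r * a) := by
        have hden : w - ρe * (w + r * a) ≠ 0 := by
          have : ρe * (w + r * a) < w := by have h := hρS1; rw [hρS, div_lt_one hw0] at h; exact h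
          linarith
        have hUS' : US = ρe * (w + r * a) / (w - ρe * (w + r * a)) := by rw [hUSv, hρS]; field_simp
        rw [hUS', hc₁]
        field_simp
        ring
      have hX := low_core x c r a γ ρe w mE mC c₁ US UN hγ0 hmE hmC.le hUS0 hxc0 hxc hs0 (by linarith) hwra (by linarith)
        hκ hUSc hUNle (key_ra x r a γ hγ hx1 ha0.le)
      have hfin : (1 - γ) * mE - D / US - γ * mE ≤ γ * mC * ((x - c) / (1 + x - c)) := by
        have e : (1 - γ) * mE - D / US - γ * mE = ((1 - γ) * mE * (US - c₁) - γ * mE * (US - UN)) / US := by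
          rw [hD]; field_simp; ring
        rw [e, div_le_iff₀ hUS0, mul_div_assoc', div_mul_eq_mul_div, le_div_iff₀ hxc]
        linarith [hX]
      have eD : γ * mE * UN * βG + D * βG = βG * ((1 - γ) * mE * c₁) := by rw [hD]; ring
      linarith [hM1, h1, h2, eP, hfin, eD]
    · -- `P1 → PG` incompatible (`ρS ≥ 1`): `P1` goes to the giants
      have hρS1 : 1 ≤ ρS := by by_contra h; push Not at h; exact hS (hcS.2 h)
      have hcapβ : γ * mE * UN * βG ≤ βG * ((1 - γ) * mE * c₁) := by
        have := mul_le_mul_of_nonneg_right hB.le hβG; linarith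
      by_cases hg : 1 ≤ 2 * γ
      · have : (1 - γ) * mE ≤ γ * mE := mul_le_mul_of_nonneg_right (by linarith) hmE
        linarith
      · push Not at hg
        have hs : 1 - ρe ≤ r * a := by
          have h1 : w ≤ ρe * (w + r * a) := by rw [hρS, le_div_iff₀ hw0] at hρS1; linarith
          have h2 : ρe * (r * a) ≤ w * (r * a) := mul_le_mul_of_nonneg_right hwe.le hra
          have h3 : (1 - ρe) * w ≤ (r * a) * w := by linarith
          exact le_of_mul_le_mul_right h3 hw0
        have t := incompat_core x c r a γ ρe mE mC hγ hx0 hx1 hr0 hrx hcx ha0 ha4 hρe hρe1 hmC.le hκ hs hg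
        have h0 : 0 ≤ γ * mE := mul_nonneg hγ0 hmE
        linarith

end WideCell

end LawDec

end Quant

end Summit.CriticalPhenomena.PercolationContinuityZ3.Theorems
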